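import Summits.BirchSwinnertonDyer.BirchSwinnertonDyer.Theorems.SignedLowerHalvesSmallImageCharSignedSelmerSatDefs
import Literature.NumberTheory.EllipticCurves.GreenbergSelmerDualDataExistsProofs
import HarnessLib

/-!
# Route `SignedLowerHalves`, crux L `SmallImageLowerHalfBothSigns` (stmt-BirchSwinnertonDyer-23599), line `rtt_w3` v10 — brick E1-π of COUNT:
# `#Sel[p] ≤ #Sel[π]^e` for a scalar-stable subgroup `Sel ≤ H¹(H, M)` when `p = u·πᵉ` in the coefficient ring (the `𝒪`-LENGTH bookkeeping
# that converts a RESIDUAL count at the uniformiser `π` into the `p`-torsion count COUNT asks for)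

LEAD `cruxlead-stmt-BirchSwinnertonDyer-23599` g6 (cell `bsd-ssimc`; `--supports stmt-BirchSwinnertonDyer-23599 --as helper`). THEOREMS ONLY (no definition, no
named fact, no instance, no `sorry`); elementary group theory + the tree's scalar action `GreenbergSelmer.scalarH1`; BSD / crux L / COUNT are NOT proved here.

WHY (memo `Lines/rtt_w3-BRIEF-E1b-g6.md` §9.1, registered stub `stub_charRoad_ns` v10, conjunct COUNT = hypothesis `hcount` of the landed glue
`SmallImageRttCharRoad.charRoad_E1_of_count`, p763022): COUNT bounds the `p`-TORSION `{s ∈ Sel^{ε,S₀K}_𝒪(K_∞,(F/𝒪)(θ)) | p•s = 0}`, whereas the residual comparison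
`W ↔ θ̄` (bricks D1–D5) naturally bounds the `π`-TORSION `Sel[π]` (`π` a uniformiser of `𝒪 = 𝒪_F`, `M[π] = k_F(θ̄)` a residual LINE; `M[p]` is not semisimple when
`F/ℚ_p` ramifies). Since `p = u·πᵉ` (`e` = ramification index, `u ∈ 𝒪ˣ`) and `Sel` is an `𝒪`-module through `scalarH1`, `Sel[p] = ker (scalarH1 π)ᵉ` and the
filtration `ker φ ⊆ ker φ² ⊆ …` gives `#Sel[p] ≤ #Sel[π]ᵉ`; with `#Sel[π] ≤ p^{f·s}` and `e·f = [F:ℚ_p]` this is `#Sel[p] ≤ p^{[F:ℚ_p]·s}` — COUNT's exponent.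

WHAT.
* §1 (any additive group `S`, `φ : S →+ S`): `finite_and_card_iterate_ker_le` — if `ker φ` is finite then every `ker φ^[k]` is finite and
  **`#ker φ^[k] ≤ (#ker φ)^k`** (`x ↦ (φ x, x − x_{φ x})` injects `ker φ^[k+1]` into `ker φ^[k] × ker φ`).
* §2 (the tree's `H¹(H, M)` with scalars `R` through `scalarH1`): `scalarH1_natCast` (`scalarH1 n = n•`), `scalarH1_pow_apply` (`scalarH1 (πᵏ) = (scalarH1 π)^[k]`),
  and for a scalar-stable subgroup `Sg ≤ H¹(H, M)` and `p = u·πᵉ` with `u` a unit: `pTorsion_subset_iterate_ker`,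
  ★ **`finite_and_card_pTorsion_le_pow`** — `Sg[π]` finite ⇒ `Sg[p]` finite and `#Sg[p] ≤ #Sg[π]^e`; `card_pTorsion_le_prime_pow` — with `#Sg[π] ≤ p^{f·s}` and
  `e·f = d`: `#Sg[p] ≤ p^{d·s}`.
* §3 the carrier instance: ★ `card_pTorsion_signedTransportSelmerInftySat_le` — the same for `Sel^{ε,S₀}_R(K_∞, M)` of the saturated transport carrier
  (`R`-stability = `scalarH1_mem_signedTransportSelmerInftySat`), in the exact set-builder shape of COUNT.

References: [EmertonPollackWeston2006] §3.1 (the `𝒪`-module structure of `Sel` through the scalars); [GreenbergVatsal2000] §2 (residual Selmer groups and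
`λ`); Serre, *Local Fields* II §3 (`p = u·πᵉ`) [folklore].
-/

set_option autoImplicit false
set_option linter.dupNamespace false -- D-0017: single-problem summit, the namespace repeats the problem name by design
noncomputable section

open scoped Classical
open NumberField IsDedekindDomain Field

universe u

namespace Summit.BirchSwinnertonDyer.BirchSwinnertonDyer.Theorems.SmallImageCharSignedSelmer

open Literature.NumberTheory.EllipticCurves Literature.NumberTheory.GaloisRepresentations

/-! ## §1. Kernels of iterates: `#ker φ^[k] ≤ (#ker φ)^k` -/

section IterateKer

variable {S : Type*} [AddCommGroup S] (φ : S →+ S)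

/-- **`#ker φ^[k] ≤ (#ker φ)^k`** for an endomorphism `φ` of an abelian group with finite kernel (and every `ker φ^[k]` is finite): the map
`x ↦ (φ x, x − x_{φ x})`, with `x_b` a chosen preimage of `b`, injects `ker φ^[k+1]` into `ker φ^[k] × ker φ`. [folklore] -/
theorem finite_and_card_iterate_ker_le (hfin : {x : S | φ x = 0}.Finite) (k : ℕ) :
    {x : S | φ^[k] x = 0}.Finite ∧ Nat.card {x : S | φ^[k] x = 0} ≤ Nat.card {x : S | φ x = 0} ^ k := by
  induction k with
  | zero =>
    have h0 : {x : S | φ^[0] x = 0} = {0} := by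
      ext x; simp only [Function.iterate_zero, id_eq, Set.mem_setOf_eq, Set.mem_singleton_iff]
    rw [h0, pow_zero, Nat.card_unique]
    exact ⟨Set.finite_singleton 0, le_rfl⟩
  | succ k ih =>
    obtain ⟨hfinB, hcardB⟩ := ih
    set A : Set S := {x : S | φ^[k + 1] x = 0} with hA
    set B : Set S := {x : S | φ^[k] x = 0} with hB
    set K₁ : Set S := {x : S | φ x = 0} with hK₁
    haveI : Finite B := hfinB.to_subtype
    haveI : Finite K₁ := hfin.to_subtype
    -- `φ` maps `A` into `B`
    have hφA : ∀ x : S, x ∈ A → φ x ∈ B := fun x hx ↦ by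
      simp only [hA, hB, Set.mem_setOf_eq] at hx ⊢
      rwa [← Function.iterate_succ_apply]
    -- a chosen preimage `pre b` of each `b` in the image, and the injection `A → B × K₁`
    let pre : B → S := fun b ↦ if h : ∃ x : S, x ∈ A ∧ φ x = b then h.choose else 0
    have hpre : ∀ (x : S) (hx : x ∈ A), φ (pre ⟨φ x, hφA x hx⟩) = φ x := fun x hx ↦ by
      have h : ∃ y : S, y ∈ A ∧ φ y = ((⟨φ x, hφA x hx⟩ : B) : S) := ⟨x, hx, rfl⟩
      simp only [pre, dif_pos h]
      exact h.choose_spec.2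
    let ι : A → B × K₁ := fun x ↦
      ⟨⟨φ x, hφA x x.2⟩, ⟨(x : S) - pre ⟨φ x, hφA x x.2⟩, by
        simp only [hK₁, Set.mem_setOf_eq, map_sub, hpre x x.2, sub_self]⟩⟩
    have hι : Function.Injective ι := by
      intro x y hxy
      have h1 : φ x = φ y := by
        have := congrArg (fun z ↦ ((z.1 : B) : S)) hxy
        exact this
      have h2 : (x : S) - pre ⟨φ x, hφA x x.2⟩ = (y : S) - pre ⟨φ y, hφA y y.2⟩ := by
        have := congrArg (fun z ↦ ((z.2 : K₁) : S)) hxy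
        exact this
      have h3 : pre ⟨φ x, hφA x x.2⟩ = pre ⟨φ y, hφA y y.2⟩ := by
        congr 1; exact Subtype.ext h1
      rw [h3] at h2
      exact Subtype.ext (sub_left_injective h2)
    haveI : Finite A := Finite.of_injective ι hι
    refine ⟨Set.toFinite A, ?_⟩
    calc Nat.card A ≤ Nat.card (B × K₁) := Nat.card_le_card_of_injective ι hι
      _ = Nat.card B * Nat.card K₁ := Nat.card_prod B K₁
      _ ≤ Nat.card K₁ ^ k * Nat.card K₁ := Nat.mul_le_mul_right _ hcardB
      _ = Nat.card K₁ ^ (k + 1) := (pow_succ _ _).symm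

end IterateKer

/-! ## §2. Scalar-stable subgroups of `H¹(H, M)`: `#Sg[p] ≤ #Sg[π]^e` when `p = u·πᵉ` -/

section Scalar

variable {G : Type u} [Group G] [TopologicalSpace G] [IsTopologicalGroup G] (H : Subgroup G)
  (M : Type u) [AddCommGroup M] [DistribMulAction G M] [TopologicalSpace M] [DiscreteTopology M]
  {R : Type*} [Ring R] [Module R M] [SMulCommClass G R M]

/-- `scalarH1 (n : R) = n •` on `H¹(H, M)` (from `scalarH1_add`, `scalarH1_one`, `scalarH1_zero`). [cite: EmertonPollackWeston2006, §3.1] -/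
theorem scalarH1_natCast_apply (n : ℕ) (c : subgroupH1 H M) : GreenbergSelmer.scalarH1 H M (n : R) c = n • c := by
  induction n with
  | zero => rw [Nat.cast_zero, GreenbergSelmer.scalarH1_zero, AddMonoidHom.zero_apply, zero_smul]
  | succ n ih =>
    rw [Nat.cast_succ, GreenbergSelmer.scalarH1_add, AddMonoidHom.add_apply, ih, GreenbergSelmer.scalarH1_one,
      AddMonoidHom.id_apply, add_smul, one_smul]

/-- `scalarH1 (πᵏ) = (scalarH1 π)^[k]` on `H¹(H, M)` (from `scalarH1_mul`, `scalarH1_one`). [cite: EmertonPollackWeston2006, §3.1] -/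
theorem scalarH1_pow_apply (π : R) (k : ℕ) (c : subgroupH1 H M) :
    GreenbergSelmer.scalarH1 H M (π ^ k) c = (GreenbergSelmer.scalarH1 H M π)^[k] c := by
  induction k generalizing c with
  | zero => rw [pow_zero, GreenbergSelmer.scalarH1_one, AddMonoidHom.id_apply, Function.iterate_zero, id_eq]
  | succ k ih =>
    rw [pow_succ, GreenbergSelmer.scalarH1_mul, AddMonoidHom.comp_apply, ih, Function.iterate_succ_apply]

variable {H M}

/-- A unit scalar acts injectively on `H¹(H, M)`: `scalarH1 u c = 0 → c = 0`. [cite: EmertonPollackWeston2006, §3.1] -/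
theorem eq_zero_of_scalarH1_unit_eq_zero {u : R} (hu : IsUnit u) {c : subgroupH1 H M}
    (hc : GreenbergSelmer.scalarH1 H M u c = 0) : c = 0 := by
  obtain ⟨v, rfl⟩ := hu
  have h : GreenbergSelmer.scalarH1 H M ((v⁻¹ : Rˣ) : R) (GreenbergSelmer.scalarH1 H M (v : R) c) = c := by
    rw [← AddMonoidHom.comp_apply, ← GreenbergSelmer.scalarH1_mul, Units.inv_mul, GreenbergSelmer.scalarH1_one,
      AddMonoidHom.id_apply]
  rw [← h, hc, map_zero]

/-- **`Sg[p] ⊆ ker (scalarH1 π)^[e]`** inside a scalar-stable subgroup `Sg ≤ H¹(H, M)` when `p = u·πᵉ` with `u` a unit (the restricted endomorphism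
`φ = scalarH1 π|_{Sg}`). [cite: EmertonPollackWeston2006, §3.1] -/
theorem pTorsion_subset_iterate_ker (Sg : AddSubgroup (subgroupH1 H M))
    (hstab : ∀ (r : R) {c : subgroupH1 H M}, c ∈ Sg → GreenbergSelmer.scalarH1 H M r c ∈ Sg)
    {p : ℕ} {π u : R} {e : ℕ} (hu : IsUnit u) (hpe : (p : R) = u * π ^ e) :
    {c : Sg | p • c = 0} ⊆
      {c : Sg | (((GreenbergSelmer.scalarH1 H M π).restrict Sg).codRestrict Sg (fun c ↦ hstab π c.2))^[e] c = 0} := by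
  intro c hc
  rw [Set.mem_setOf_eq] at hc ⊢
  -- the restricted endomorphism iterates to the restriction of `scalarH1 (πᵉ)`
  have hiter : ∀ (k : ℕ) (d : Sg),
      (((((GreenbergSelmer.scalarH1 H M π).restrict Sg).codRestrict Sg (fun c ↦ hstab π c.2))^[k] d : Sg) : subgroupH1 H M) =
        (GreenbergSelmer.scalarH1 H M π)^[k] (d : subgroupH1 H M) := by
    intro k
    induction k with
    | zero => intro d; rfl
    | succ k ih => intro d; rw [Function.iterate_succ_apply', Function.iterate_succ_apply', ← ih]; rfl
  apply Subtype.ext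
  rw [hiter, AddSubgroup.coe_zero, ← scalarH1_pow_apply]
  -- `p • c = 0` in `H¹`, i.e. `scalarH1 (u πᵉ) c = 0`, and `u` is a unit
  have hp : GreenbergSelmer.scalarH1 H M (p : R) (c : subgroupH1 H M) = 0 := by
    rw [scalarH1_natCast_apply, ← AddSubgroupClass.coe_nsmul, hc, AddSubgroup.coe_zero]
  rw [hpe, GreenbergSelmer.scalarH1_mul, AddMonoidHom.comp_apply] at hp
  exact eq_zero_of_scalarH1_unit_eq_zero hu hp

/-- ★ **`#Sg[p] ≤ #Sg[π]^e`, both finite, for a scalar-stable subgroup `Sg ≤ H¹(H, M)` with `Sg[π]` finite and `p = u·πᵉ`, `u ∈ Rˣ`.**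
[cite: EmertonPollackWeston2006, §3.1] [cite: GreenbergVatsal2000, §2 Prop. (2.8)] -/
theorem finite_and_card_pTorsion_le_pow (Sg : AddSubgroup (subgroupH1 H M))
    (hstab : ∀ (r : R) {c : subgroupH1 H M}, c ∈ Sg → GreenbergSelmer.scalarH1 H M r c ∈ Sg)
    {p : ℕ} {π u : R} {e : ℕ} (hu : IsUnit u) (hpe : (p : R) = u * π ^ e)
    (hfin : {c : Sg | GreenbergSelmer.scalarH1 H M π c = 0}.Finite) :
    {c : Sg | p • c = 0}.Finite ∧
      Nat.card {c : Sg | p • c = 0} ≤ Nat.card {c : Sg | GreenbergSelmer.scalarH1 H M π c = 0} ^ e := by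
  set φ : Sg →+ Sg := ((GreenbergSelmer.scalarH1 H M π).restrict Sg).codRestrict Sg (fun c ↦ hstab π c.2) with hφ
  have hker : {c : Sg | φ c = 0} = {c : Sg | GreenbergSelmer.scalarH1 H M π c = 0} := by
    ext c
    simp only [Set.mem_setOf_eq, hφ]
    rw [Subtype.ext_iff]
    rfl
  have hfinφ : {c : Sg | φ c = 0}.Finite := by rw [hker]; exact hfin
  obtain ⟨hfinE, hcardE⟩ := finite_and_card_iterate_ker_le φ hfinφ e
  have hsub := pTorsion_subset_iterate_ker Sg hstab hu hpe
  rw [hker] at hcardE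
  haveI : Finite {c : Sg | φ^[e] c = 0} := hfinE.to_subtype
  exact ⟨hfinE.subset hsub,
    (Nat.card_le_card_of_injective (Set.inclusion hsub) (Set.inclusion_injective hsub)).trans hcardE⟩

/-- **Numerical form: `#Sg[π] ≤ p^{f·s}` and `e·f = d` give `#Sg[p] ≤ p^{d·s}`** (`d = [F:ℚ_p] = e·f` for `R = 𝒪_F`). [folklore] -/
theorem card_pTorsion_le_prime_pow (Sg : AddSubgroup (subgroupH1 H M))
    (hstab : ∀ (r : R) {c : subgroupH1 H M}, c ∈ Sg → GreenbergSelmer.scalarH1 H M r c ∈ Sg)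
    {p : ℕ} {π u : R} {e : ℕ} (hu : IsUnit u) (hpe : (p : R) = u * π ^ e)
    (hfin : {c : Sg | GreenbergSelmer.scalarH1 H M π c = 0}.Finite) {f s d : ℕ} (hef : e * f = d)
    (hcard : Nat.card {c : Sg | GreenbergSelmer.scalarH1 H M π c = 0} ≤ p ^ (f * s)) :
    {c : Sg | p • c = 0}.Finite ∧ Nat.card {c : Sg | p • c = 0} ≤ p ^ (d * s) := by
  obtain ⟨hfinp, hle⟩ := finite_and_card_pTorsion_le_pow Sg hstab hu hpe hfin
  refine ⟨hfinp, hle.trans ?_⟩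
  calc Nat.card {c : Sg | GreenbergSelmer.scalarH1 H M π c = 0} ^ e ≤ (p ^ (f * s)) ^ e := Nat.pow_le_pow_left hcard e
    _ = p ^ (d * s) := by rw [← pow_mul, ← hef]; ring_nf

end Scalar

/-! ## §3. The instance COUNT uses: the saturated transport carrier -/

section Carrier

variable {K : Type u} [Field K] [NumberField K] {p : ℕ} [Fact p.Prime] (κ : ZpExtension K p)
  (M : Type u) [AddCommGroup M] [DistribMulAction (absoluteGaloisGroup K) M] [TopologicalSpace M] [DiscreteTopology M]
  (R : Type*) [Ring R] [Module R M] [SMulCommClass (absoluteGaloisGroup K) R M]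
  (V : WeierstrassCurve K) (j : V.geomPrimaryTorsion p →+ M) (S₀ : Set (HeightOneSpectrum (𝓞 K))) (ε : ℤˣ)

/-- ★ **E1-π for the carrier.** For `Sel = Sel^{ε,S₀}_R(K_∞, M)` (saturated transport carrier; `R`-stable by `scalarH1_mem_signedTransportSelmerInftySat`) and
`p = u·πᵉ` in `R` with `u` a unit: if `Sel[π] = {s | scalarH1 π s = 0}` is finite with `#Sel[π] ≤ p^{f·s}` and `e·f = d`, then
`{s ∈ Sel | p•s = 0}` is finite with `Nat.card ≤ p^{d·s}` — the shape of COUNT's conclusion with `d = [F:ℚ_p]`, `s = λ(X^ε_W) + Σδ_W`.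
[cite: EmertonPollackWeston2006, §3.1] [cite: GreenbergVatsal2000, §2 Prop. (2.8)] -/
theorem card_pTorsion_signedTransportSelmerInftySat_le {π u : R} {e : ℕ} (hu : IsUnit u) (hpe : (p : R) = u * π ^ e)
    (hfin : {s : signedTransportSelmerInftySat κ M R V j S₀ ε |
      GreenbergSelmer.scalarH1 κ.kerSubgroup M π s = 0}.Finite) {f s d : ℕ} (hef : e * f = d)
    (hcard : Nat.card {s : signedTransportSelmerInftySat κ M R V j S₀ ε |
      GreenbergSelmer.scalarH1 κ.kerSubgroup M π s = 0} ≤ p ^ (f * s)) :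
    {s : signedTransportSelmerInftySat κ M R V j S₀ ε | p • s = 0}.Finite ∧
      Nat.card {s : signedTransportSelmerInftySat κ M R V j S₀ ε | p • s = 0} ≤ p ^ (d * s) :=
  card_pTorsion_le_prime_pow (signedTransportSelmerInftySat κ M R V j S₀ ε)
    (fun r _ hc ↦ scalarH1_mem_signedTransportSelmerInftySat κ M R V j S₀ ε r hc) hu hpe hfin hef hcard

end Carrier

end Summit.BirchSwinnertonDyer.BirchSwinnertonDyer.Theorems.SmallImageCharSignedSelmer

end
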